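import Mathlib
import Literature.Computability.AlgebraicComplexity.LocalStrongUSP
import Summits.MatrixMultiplication.MatrixMultiplication.Theses.ThinBlockAlpha

/-!
# Sketch — first lemmas of the crux-idea cards for `SkewLocalStrongUSP`
(stmt-MatrixMultiplication-10598; planner-cruxidea-stmt-MatrixMultiplication-10598-2-0, round 1, ideator 2)

Conventions: symbols `0,1,2` = CKSU's `1,2,3`; a row `u : Fin (7k) → Fin 3` of class `(3k,k,3k)` ↔ the ordered
partition `X_u ⊔ Y_u ⊔ Z_u` (`X` = symbol 0, `Y` = symbol 1, `Z` = symbol 2).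

Card `strong-seed-transfer`: `IsStrongUSP`, `Prop34Typed`, `SkewStrongSeed`, `Transfer`.
Card `kernel-sink-programme`: `pieces`, `KernelForm`, `kernelForm_iff` (statement), `SkewWeakLocalUSP`,
  `FurediThreshold`, `DangerousPairsForced`.
Card `gkv-twin-partition-chaining`: `fixedMiddle_clique` (statement), `PolarisedFamily`, `PolarisedAmplification`.
Everything is a `Prop` / statement; nothing is asserted without `sorry` being visible.
-/

namespace Summit.MatrixMultiplication.MatrixMultiplication.Cruxes.SkewLocalStrongUSP.Ideator2

open Finset
open Literature.Computability.AlgebraicComplexity (IsLocalStrongUSP localStrongUSPPatterns)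
open Summit.MatrixMultiplication.MatrixMultiplication.Theses.ThinBlockAlpha (SkewLocalStrongUSP)

/-! ## Common bookkeeping -/

/-- the three pieces of a row (`s = 0,1,2` ↦ `X,Y,Z`). -/
def piece {n : ℕ} (u : Fin n → Fin 3) (s : Fin 3) : Finset (Fin n) := univ.filter fun i => u i = s

/-- the skew class `(3k,k,3k)` of width `7k`. -/
def InSkewClass (k : ℕ) (u : Fin (7 * k) → Fin 3) : Prop :=
  (piece u 0).card = 3 * k ∧ (piece u 1).card = k

/-- the local-strong-USP triple condition in the crux's literal form. -/
def LSUSP {n : ℕ} (U : Finset (Fin n → Fin 3)) : Prop :=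
  ∀ u ∈ U, ∀ v ∈ U, ∀ w ∈ U, (u ≠ v ∨ v ≠ w) → ∃ i, (u i, v i, w i) ∈ localStrongUSPPatterns

/-! ## Card `strong-seed-transfer` -/

/-- CKSU 2005 §3.1 strong USP ("exactly two of `(π₁u)ᵢ=1, (π₂u)ᵢ=2, (π₃u)ᵢ=3`" = the crux's pattern set), rows an
injective family over a finite index type. -/
def IsStrongUSP {ι : Type*} [Fintype ι] {w : ℕ} (row : ι → Fin w → Fin 3) : Prop :=
  Function.Injective row ∧
    ∀ π₁ π₂ π₃ : Equiv.Perm ι, ¬(π₁ = π₂ ∧ π₂ = π₃) →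
      ∃ u : ι, ∃ i : Fin w, (row (π₁ u) i, row (π₂ u) i, row (π₃ u) i) ∈ localStrongUSPPatterns

/- NOTE (correction found this session): strong USPs are NOT closed under Cartesian product in general —
Anderson–Le arXiv:2307.06463 §4.2: `P = {2233, 1232, 1123, 3311}` is an SUSP but `P × P` is not. Product-closed
intermediate classes: local strong USPs (CKSU) ⊆ SIMPLIFIABLE SUSPs (Anderson–Le Def. 5, Lemma 8) ⊆ strong USPs.
The transfer below therefore avoids products altogether: it asks for strong seeds at infinitely many widths and
applies Prop. 34 to each seed directly (the factor `e` of Stirling is put into the rate condition). -/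

/-- First lemma [CKSU arXiv:math/0511460 Prop. 34, p. 10, TYPED]: the `|U|!` concatenations `U_π` of all rows of a
strong USP form a local strong USP of width `|U|·w`; every `U_π` has the TOTAL composition of `U`. Provable now (M). -/
def Prop34Typed : Prop :=
  ∀ (N w : ℕ) (row : Fin N → Fin w → Fin 3), IsStrongUSP row →
    ∀ (L : ℕ) (e : Fin L ↪ Equiv.Perm (Fin N)),
      IsLocalStrongUSP (fun (a : Fin L) (j : Fin (N * w)) =>
        row ((e a) (finProdFinEquiv.symm j).1) (finProdFinEquiv.symm j).2)
  -- (`finProdFinEquiv.symm j : Fin N × Fin w`: column `j` of `U_π` is entry `(π u, i)`; the order of concatenation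
  --  is immaterial for the local strong USP property.)

/-- C⁺ (the transferred form): for every `δ`, skew STRONG seeds at infinitely many widths `w`: a strong USP whose
TOTAL symbol counts are `3:1:3` and whose size satisfies `log₂ N ≥ w·(h(1/7) − δ/7) + log₂ e`, i.e.
`e^7 · 7^{7w} ≤ N^7 · 2^{δw} · 6^{6w}` (`7·h(1/7) = log₂(7^7/6^6)`).  By Prop. 34 each seed gives one local strong USP of
width `N·w` in the class `(3k,k,3k)`, `k = N w / 7`, with `N! ≥ (N/e)^N ≥ C(7k,k)·2^{-δk}` rows; `k ≥ w/7 → ∞`. -/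
def SkewStrongSeed : Prop :=
  ∀ δ : ℝ, 0 < δ → ∀ w₀ : ℕ, ∃ (w N : ℕ) (row : Fin N → Fin w → Fin 3), w₀ ≤ w ∧ IsStrongUSP row ∧ 0 < N ∧
    7 * (∑ u, (piece (row u) 1).card) = N * w ∧
    (∑ u, (piece (row u) 0).card) = 3 * ∑ u, (piece (row u) 1).card ∧
    Real.exp 7 * (7 : ℝ) ^ (7 * w) ≤ (N : ℝ) ^ 7 * (2 : ℝ) ^ (δ * w) * (6 : ℝ) ^ (6 * w)

/-- The transfer claim of the card: C⁺ ⇒ crux (Prop. 34 + Stirling, seed by seed). The converse is immediate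
(local ⇒ strong; totals from the class; the crux at δ/2 beats the `O(log w)` terms), so C⁺ ⇔ crux. -/
def Transfer : Prop := SkewStrongSeed → SkewLocalStrongUSP

/-! ## Card `kernel-sink-programme` -/

/-- Δ-system (sunflower) form of "no witness": for `u ≠ w` the would-be kernel is `K = X_u ∩ Z_w`; a third row `v` is
bad iff `K ⊆ Y_v` and `Y_v ∩ (X_u ∪ Z_w) ⊆ K`. `KernelForm U` says: pieces injective and no such `(u,v,w)`. -/
def KernelForm {n : ℕ} (U : Finset (Fin n → Fin 3)) : Prop :=
  (∀ s : Fin 3, Set.InjOn (fun u => piece u s) (U : Set (Fin n → Fin 3))) ∧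
    ∀ u ∈ U, ∀ w ∈ U, u ≠ w → ∀ v ∈ U,
      ¬ (piece u 0 ∩ piece w 2 ⊆ piece v 1 ∧ piece v 1 ∩ (piece u 0 ∪ piece w 2) ⊆ piece u 0 ∩ piece w 2)

/-- First lemma (provable now, S): inside one composition class the crux's triple condition is EXACTLY the kernel form.
(Degenerate triples ⇔ injectivity of the three piece maps; distinct triples ⇔ no tricoloured Δ-system.) -/
theorem kernelForm_iff (k : ℕ) (U : Finset (Fin (7 * k) → Fin 3)) (hU : ∀ u ∈ U, InSkewClass k u) :
    LSUSP U ↔ KernelForm U := by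
  sorry

/-- Stage 1 (provable in principle, L-sized formalisation: Coppersmith–Winograd 1990 §6 Salem–Spencer pruning =
Strassen's degeneration of TIGHT supports, run inside the type `(3/7,1/7,3/7)`; CKSU Thm. 13 / §7 "local USPs achieve the
USP capacity"): skew WEAK local USPs (pattern `(1,2,3)` also allowed, i.e. only kernel-free re-tilings forbidden) reach
the unique-pieces bound. -/
def SkewWeakLocalUSP : Prop :=
  ∀ δ : ℝ, 0 < δ → ∀ k₀ : ℕ, ∃ k : ℕ, k₀ ≤ k ∧ ∃ U : Finset (Fin (7 * k) → Fin 3),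
    (∀ u ∈ U, ∀ v ∈ U, ∀ w ∈ U, (u ≠ v ∨ v ≠ w) →
        ∃ i, (u i, v i, w i) ∈ insert ((0 : Fin 3), (1 : Fin 3), (2 : Fin 3)) localStrongUSPPatterns) ∧
    (∀ u ∈ U, InSkewClass k u) ∧ (Nat.choose (7 * k) k : ℝ) ≤ (2 : ℝ) ^ (δ * k) * U.card

/-- Füredi 1984 (threshold Bollobás set-pair inequality; Literature fact, UNPROVED in tree): `a`-sets `Aᵢ`, `b`-sets
`Bᵢ` with `|Aᵢ ∩ Bᵢ| ≤ t` and `|Aᵢ ∩ Bⱼ| ≥ t+1 (i ≠ j)` number at most `C(a+b−2t, a−t)`. -/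
def FurediThreshold : Prop :=
  ∀ (n m a b t : ℕ) (A B : Fin m → Finset (Fin n)),
    (∀ i, (A i).card = a) → (∀ i, (B i).card = b) → (∀ i, (A i ∩ B i).card ≤ t) →
    (∀ i j, i ≠ j → t + 1 ≤ (A i ∩ B j).card) → m ≤ Nat.choose (a + b - 2 * t) (a - t)

/-- The Füredi-deficit law (provable from `FurediThreshold` by deleting one row per dangerous pair): a skew local strong
USP with `m` rows has at least `m − C(4k,2k)` ordered pairs `u ≠ w` with `|X_u ∩ Z_w| ≤ k` ("dangerous pairs"), each of
which forbids at least one `k`-set from being a middle piece. Since `C(4k,2k) = 2^{4k} ≪ C(7k,k) = 2^{4.14k}`, near the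
crux's size almost every row sits in a dangerous pair: any construction needs a KERNEL SINK. -/
def DangerousPairsForced : Prop :=
  FurediThreshold →
    ∀ (k : ℕ) (U : Finset (Fin (7 * k) → Fin 3)), (∀ u ∈ U, InSkewClass k u) → LSUSP U →
      U.card ≤ Nat.choose (4 * k) (2 * k) +
        ((U ×ˢ U).filter fun p => p.1 ≠ p.2 ∧ (piece p.1 0 ∩ piece p.2 2).card ≤ k).card

/-! ## Card `gkv-twin-partition-chaining` -/

/-- First lemma (provable now, S): a family with a CONSTANT middle piece `Y` (arbitrary distinct halvings of `Yᶜ`)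
witnesses EVERY ordered triple `(u,v,w)` with `u ≠ w` — all configurations except the `Y`-repetition `(u,v,u)`.
Its rate is `log₂ C(6k,3k) / 7k = 6/7` bit/column `> h(1/7) = 0.5917`: the 𝒢-cliques of the chaining. -/
theorem fixedMiddle_clique (k : ℕ) (U : Finset (Fin (7 * k) → Fin 3)) (hU : ∀ u ∈ U, InSkewClass k u)
    (hY : ∀ u ∈ U, ∀ v ∈ U, piece u 1 = piece v 1) :
    ∀ u ∈ U, ∀ v ∈ U, ∀ w ∈ U, u ≠ w → ∃ i, (u i, v i, w i) ∈ localStrongUSPPatterns := by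
  sorry
-- (the class hypothesis is needed: with |X_u| ≠ |X_w| one could have X_u ⊊ X_w and then no witness exists.)

/-- kernel-polarised disjoint set-pair systems in `[7k]`: the 𝒢-cliques of the PROVABLE amplification. -/
def PolarisedFamily (k m : ℕ) (X Z : Fin m → Finset (Fin (7 * k))) : Prop :=
  (∀ u, (X u).card = 3 * k ∧ (Z u).card = 3 * k ∧ Disjoint (X u) (Z u)) ∧
    ∀ u w, u ≠ w → k + 1 ≤ (X u ∩ Z w).card

/-- Amplification lemma (provable, L: Gargano–Körner–Vaccaro twin partitions + Markov chaining over the type class,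
Csiszár–Körner 2nd ed. Thm. 11.21, with ℱ = middle-piece-distinct cliques and 𝒢 = polarised cliques; both clique notions
are permutation-invariant and hereditary, and the first/last-differing-segment analysis closes ALL local-strong-USP
configurations): a polarised family of size `m` in `[7k]` yields skew local strong USPs of width `7kt` with
`≥ 3^{-7k}·(m/(12k+2))^{t-1}` rows (entropy count of the Markov chain: per-segment loss = log #classes-overhead
`≤ log(2(1+ln m)) ≤ log(12k+2)`; pinning both end segments costs `|T| ≤ 3^{7k}`). (By Füredi `m ≤ C(4k,2k)`, so this
alone caps at rate `4/7` bit/column as `k → ∞`.) -/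
def PolarisedAmplification : Prop :=
  ∀ (k m : ℕ) (X Z : Fin m → Finset (Fin (7 * k))), PolarisedFamily k m X Z → m ≤ Nat.choose (7 * k) k →
    ∀ t : ℕ, 2 ≤ t →
      ∃ U : Finset (Fin (7 * (k * t)) → Fin 3), LSUSP U ∧ (∀ u ∈ U, InSkewClass (k * t) u) ∧
        ((m : ℝ) / (12 * k + 2)) ^ (t - 1) ≤ (3 : ℝ) ^ (7 * k) * U.card

end Summit.MatrixMultiplication.MatrixMultiplication.Cruxes.SkewLocalStrongUSP.Ideator2
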